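import Summits.BirchSwinnertonDyer.BirchSwinnertonDyer.Theorems.EisensteinPrimesBSDpOnCellCNotGVDoorsOfThmD
import Summits.BirchSwinnertonDyer.Rank1Residual.X2.CellCBDPValueContinuousDisplay
import HarnessLib

/-!
# Crux 4 `BSDpOnCellC` (stmt-BirchSwinnertonDyer-19034), line b1 v9: `stub_c2` (the value atom at `p = 3`, both
# signs) CONSUMED BY NAME from ONE sign-free value theorem in continuous-function currency at `3 ‖ N`, and the
# crux / the ψ-even doors AT THE PRE TIER with that theorem in place of `stub_c2` (cell `bsd-eis`, seat
# `bsd-eis-cgshw` g14; RULING L43 (2) «COMMISSION (O2)-LZZ@3», kernel side — the consumer)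

HONEST FRAMING (cell `bsd-eis`, run/shared/lean/pub/bsd-eis/): theorems only (kernel glue); nothing booked; X2
stays CONSTRUCTION-SHAPED; no label or count moves; BSD is not proved by any of this. Every theorem is
CONDITIONAL on its displayed binders, among them `h3c` = the BDP value at `𝟙` in SIGN-FREE continuous-function
currency at `p = 3` (`X2.BDPValueContinuousDisplayAt W 3`, an `@[conjecture]` attach point — NOT in print in
Castella's currency; intended sources: Liu–Zhang–Zhang 2018 Thm. 3.8 ∧ 3.10 ∧ Prop. 4.12 [PUB] through a kernel
rescale carrying c2v MEMO-2's factor ledger `‖𝔠‖₃ = 1`, or road HK (cgshw MEMO-13)), the 16 published named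
facts + [cas-split] (= v9 `stub_publishedFacts` VERBATIM), Keller–Yin Thm. D BY NAME (PREPRINT, gapped at
L1754), and — for the whole cell only — crux 3 `MazurMCOnCellB`.

## Why

RULING L43 (2) re-priced the kernel closure of `stub_c2` (= c2♭ `NonsplitBDPValueOnTreeInt W 3` ∧ c2s♭
`SplitBDPValueOnTreeInt W 3`, ∀-frame shape) as the cell's lever on row B11: it moves the ψ-even `(class, 3)`
entries (2 552 non-split + 7 429 split class-wide) into the bucket «literal on Keller–Yin Thm. D alone»
(`Reoriented.bsdpOnCellCNotGV_of_thmD_OPEN`, p497161, carries `stub_c2` as its only non-PRE/PUB binder). A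
value theorem printed in a foreign normalisation (LZZ18; road HK) delivers its value with VIRTUAL periods,
i.e. in continuous-function currency, and is SIGN-FREE. This file makes that currency the by-name input:

* §1 **`stub_c2_of_continuousDisplay_three`**: `(∀ W, X2.BDPValueContinuousDisplayAt W 3)` ⟹ v9's `stub_c2`
  VERBATIM (both conjuncts; one-sided ♭-V1RIG on either sign, `X2.nonsplitBDPValueOnTreeInt_of_signFree` /
  `X2.splitBDPValueOnTreeInt_of_signFree`).
* §2 **`bsdpOnCellC_of_stubs_of_continuousDisplay_three`**: the v9 composition `bsdpOnCellC_of_stubs_reoriented`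
  (p488773) with `stub_c2` replaced by `h3c` — `BSDpOnCellC` (route decl BY NAME) from `stub_publishedFacts`,
  `h3c`, re-oriented `stub_c3` and crux 3, all other slots VERBATIM.
* §3 **`bsdpOnCellC_of_continuousDisplay_three_of_thmD_OPEN`** (p489431 with `stub_c2 ↦ h3c`): the crux at the PRE
  tier from PUB(16) + [cas-split] + `h3c` + Thm. D by name + crux 3; and
  **`bsdpOnCellCNotGV_of_continuousDisplay_three_of_thmD_OPEN`** (p497161's `…NotGV_of_thmD_OPEN` with
  `stub_c2 ↦ h3c`): `CellC ∩ {¬GVPar} ⇒ BSD(E,p)` at EVERY odd `p` from PUB(16) + [cas-split] + `h3c` + Thm. D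
  by name — NO crux 3. So the day a kernel `lzz_rescale` (or any proof of `X2.BDPValueContinuousDisplayAt W 3`,
  e.g. via the pointwise contract `X2.bdpValueContinuousDisplayAt_of_pointwise`) lands, ALL ψ-even B11 entries
  (9 981 @3 + 409 @5/@7 class-wide) read «literal on Keller–Yin Thm. D [PRE] alone» by these names.

What this is NOT: not a value theorem at `3 ‖ N`; not a proof of Thm. D or of any main conjecture; not a
change of the registered skeleton (v9 f9bf0946 stands: `stub_c2` stays the registered input, closed BY NAME by
§1 the day `h3c` is a theorem); nothing about the ψ-odd half beyond p488773's use of crux 3.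

References: [LiuZhangZhang2018] Thm. 3.8, Thm. 3.10, Prop. 4.12 (arXiv:1511.08172 pp. 18, 23);
[Castella2018Exceptional] Thms. 2.10–2.11; [Hsieh2014] Thm. 1; [KellerYin2024] Thm. D = Thm. 5.1.3 (PRE);
[GreenbergVatsal2000] Thm. (1.3); [CastellaEtAl2021] Thm. 5.3.1; [Miller2011LMS] Def. 1.1; RULINGS L11 / L32 /
L33 / L43; c2v MEMO-1/2; cgshw MEMO-13/17/18.
-/

set_option autoImplicit false
set_option linter.dupNamespace false

noncomputable section

open scoped Classical MatrixGroups ModularForm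

open CongruenceSubgroup WeierstrassCurve NumberField IsDedekindDomain Field PowerSeries
  Literature.NumberTheory.EllipticCurves Literature.NumberTheory.EllipticCurves.GreenbergSelmer
  Literature.NumberTheory.EllipticCurves.ModularForms Literature.NumberTheory.QuadraticFields
  Literature.NumberTheory.EllipticCurves.Rank1Residual
  Literature.NumberTheory.EllipticCurves.Rank1Residual.Typed
  Literature.NumberTheory.EllipticCurves.GreenbergVatsal2000
  Literature.NumberTheory.EllipticCurves.Wuthrich2014
  Literature.NumberTheory.EllipticCurves.SteinWuthrich2013
  Literature.NumberTheory.EllipticCurves.Castella2018Exceptional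
  Literature.NumberTheory.GaloisRepresentations Literature.NumberTheory.GaloisCohomology
  Literature.NumberTheory.Automorphic
  Summit.BirchSwinnertonDyer.Rank1Residual.X11b.AcSelmer
  Summit.BirchSwinnertonDyer.Rank1Residual.X11b.Halves
  Summit.BirchSwinnertonDyer.Rank1Residual.X11b
  Summit.BirchSwinnertonDyer.Rank1Residual.X2
  Summit.BirchSwinnertonDyer.Rank1Residual

namespace Summit.BirchSwinnertonDyer.BirchSwinnertonDyer.Theorems.Reoriented

/-! ### §1 `stub_c2` from the sign-free continuous display at `p = 3` -/

/-- **v9's `stub_c2` VERBATIM (c2♭ at the non-split and c2s♭ at the split X2c pairs with `p = 3`) from ONE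
sign-free value theorem in continuous-function currency at `3 ‖ N`** (`h3c : ∀ W, X2.BDPValueContinuousDisplayAt W 3`).
Proof: substitute `p = 3`; the non-split conjunct is `X2.nonsplitBDPValueOnTreeInt_of_signFree`, the split
conjunct `X2.splitBDPValueOnTreeInt_of_signFree` (one-sided ♭-V1RIG, either sign). CONDITIONAL on `h3c` (NOT in
print in this currency at `p = 3`; LZZ18 / road HK are the intended sources); nothing booked.
[cite: LiuZhangZhang2018, Thm. 3.8 and Thm. 3.10 (arXiv:1511.08172 p. 18) (intended source of h3c; nothing asserted)]
[cite: Castella2018, Thm. 3.1–3.2 (arXiv:1704.06608 p. 9) (the display's normalisation)] -/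
theorem stub_c2_of_continuousDisplay_three
    (h3c : ∀ (W : WeierstrassCurve ℚ) [W.IsElliptic] [W.IsGloballyMinimal],
      X2.BDPValueContinuousDisplayAt W 3) :
    (∀ (W : WeierstrassCurve ℚ) [W.IsElliptic] [W.IsGloballyMinimal] (p : ℕ) [Fact p.Prime],
        p = 3 → CellC W p → ¬ W.HasSplitMultiplicativeReductionAtPrime p → NonsplitBDPValueOnTreeInt W p) ∧
      (∀ (W : WeierstrassCurve ℚ) [W.IsElliptic] [W.IsGloballyMinimal] (p : ℕ) [Fact p.Prime],
        p = 3 → CellC W p → W.HasSplitMultiplicativeReductionAtPrime p → SplitBDPValueOnTreeInt W p) := by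
  refine ⟨fun W _ _ p _ hp3 _ _ ↦ ?_, fun W _ _ p _ hp3 _ _ ↦ ?_⟩
  · subst hp3
    exact X2.nonsplitBDPValueOnTreeInt_of_signFree (h3c W)
  · subst hp3
    exact X2.splitBDPValueOnTreeInt_of_signFree (h3c W)

/-! ### §2 The v9 composition with `stub_c2` replaced by the continuous display -/

/-- **Crux 4 `BSDpOnCellC` from v9's `stub_publishedFacts` (`hPub`), the sign-free continuous display at `p = 3`
(`h3c`, in place of `stub_c2`), the re-oriented `stub_c3` (`h3`, VERBATIM) and crux 3 (`hMCB`).** =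
`bsdpOnCellC_of_stubs_reoriented` (p488773) ∘ `stub_c2_of_continuousDisplay_three`. CONDITIONAL on every listed
binder; nothing booked; X2 CONSTRUCTION-SHAPED; no label change.
[cite: LiuZhangZhang2018, Thm. 3.8 and Thm. 3.10 (arXiv:1511.08172 p. 18) (intended source of h3c; nothing asserted)]
[cite: Castella2018Exceptional, Thm. 2.10 and Thm. 2.11 (arXiv:1507.04260 pp. 13–14)]
[cite: Hsieh2014, Thm. 1 (arXiv:1112.1580 pp. 3–4)] [claim: KellerYin2024, status: under-review]
[cite: CastellaEtAl2021, Thm. 5.3.1] [cite: Miller2011LMS, Def. 1.1] -/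
theorem bsdpOnCellC_of_stubs_of_continuousDisplay_three
    (hPub : (lambdaMu_multiplicative_of_gvPar ∧ thm16_charIdeal_dvd_multiplicative_of_reducible ∧
      thm61_splitMultiplicative ∧ thm61_nonsplitMultiplicative ∧
      (∀ (W : WeierstrassCurve ℚ) [W.IsElliptic] [W.IsGloballyMinimal] (p : ℕ) [Fact p.Prime],
        greenberg_stevens (W := W) (p := p)) ∧
      exists_isNewformOf ∧
      (∀ (K : Type) [Field K] [NumberField K], poitouTate_selmerStructure_duality K) ∧
      (∀ (K : Type) [Field K] [NumberField K], poitouTate_sha_tateDual K) ∧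
      hsieh2014_exists_anticyclotomicPAdicLFunction ∧
      (∀ (N : ℕ) [NeZero N] (W : WeierstrassCurve ℚ) (K : Type) [Field K] [NumberField K],
        gross_zagier N W K) ∧
      (∀ (N : ℕ) [NeZero N] (W : WeierstrassCurve ℚ) (K : Type) [Field K] [NumberField K],
        kolyvagin N W K) ∧
      rank_eq_analyticRank_of_analyticRank_le_one ∧ HoffsteinLuo1997_exists_twist_L_one_ne_zero ∧
      mazur_not_dvd_maninConstant_of_odd ∧ bsdRHS_eq_of_isIsogenous) ∧
      thm210_thm211_bdpDisplay_pNew)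
    (h3c : ∀ (W : WeierstrassCurve ℚ) [W.IsElliptic] [W.IsGloballyMinimal],
      X2.BDPValueContinuousDisplayAt W 3)
    (h3 : (∀ (W : WeierstrassCurve ℚ) [W.IsElliptic] [W.IsGloballyMinimal] (p : ℕ) [Fact p.Prime],
        CellC W p → ¬ W.HasSplitMultiplicativeReductionAtPrime p → NonsplitIMCEqOnTreeIntOther W p) ∧
      (∀ (W : WeierstrassCurve ℚ) [W.IsElliptic] [W.IsGloballyMinimal] (p : ℕ) [Fact p.Prime],
        CellC W p → W.HasSplitMultiplicativeReductionAtPrime p → SplitIMCEqOnTreeIntOther W p))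
    (hMCB : Summit.BirchSwinnertonDyer.BirchSwinnertonDyer.Theses.EisensteinPrimes.MazurMCOnCellB) :
    Summit.BirchSwinnertonDyer.BirchSwinnertonDyer.Theses.EisensteinPrimes.BSDpOnCellC :=
  bsdpOnCellC_of_stubs_reoriented hPub (stub_c2_of_continuousDisplay_three h3c) h3 hMCB

/-! ### §3 At the PRE tier: Keller–Yin Thm. D by name -/

/-- **Crux 4 `BSDpOnCellC` AT THE PRE TIER with the value atom in continuous-function currency:** from the 16
published facts + [cas-split] (`hPub`), the sign-free continuous display at `p = 3` (`h3c`), Keller–Yin Thm. D BY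
NAME (`hD`, PREPRINT, gapped) and crux 3 (`hMCB`). = `bsdpOnCellC_of_thmD_OPEN` (p489431) with `stub_c2`
supplied by §1. A `conditional-result`: credits nothing, books nothing.
[claim: KellerYin2024, status: under-review] [cite: KellerYin2024, Thm. D = Thm. 5.1.3 (arXiv:2402.12781v2 L306–L309)]
[cite: LiuZhangZhang2018, Thm. 3.8 and Thm. 3.10 (arXiv:1511.08172 p. 18) (intended source of h3c; nothing asserted)]
[cite: Castella2018Exceptional, Thm. 2.10 and Thm. 2.11 (arXiv:1507.04260 pp. 13–14)]
[cite: Hsieh2014, Thm. 1 (arXiv:1112.1580 pp. 3–4)] [cite: CastellaEtAl2021, Thm. 5.3.1] [cite: Miller2011LMS, Def. 1.1] -/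
theorem bsdpOnCellC_of_continuousDisplay_three_of_thmD_OPEN
    (hPub : (lambdaMu_multiplicative_of_gvPar ∧ thm16_charIdeal_dvd_multiplicative_of_reducible ∧
      thm61_splitMultiplicative ∧ thm61_nonsplitMultiplicative ∧
      (∀ (W : WeierstrassCurve ℚ) [W.IsElliptic] [W.IsGloballyMinimal] (p : ℕ) [Fact p.Prime],
        greenberg_stevens (W := W) (p := p)) ∧
      exists_isNewformOf ∧
      (∀ (K : Type) [Field K] [NumberField K], poitouTate_selmerStructure_duality K) ∧
      (∀ (K : Type) [Field K] [NumberField K], poitouTate_sha_tateDual K) ∧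
      hsieh2014_exists_anticyclotomicPAdicLFunction ∧
      (∀ (N : ℕ) [NeZero N] (W : WeierstrassCurve ℚ) (K : Type) [Field K] [NumberField K],
        gross_zagier N W K) ∧
      (∀ (N : ℕ) [NeZero N] (W : WeierstrassCurve ℚ) (K : Type) [Field K] [NumberField K],
        kolyvagin N W K) ∧
      rank_eq_analyticRank_of_analyticRank_le_one ∧ HoffsteinLuo1997_exists_twist_L_one_ne_zero ∧
      mazur_not_dvd_maninConstant_of_odd ∧ bsdRHS_eq_of_isIsogenous) ∧
      thm210_thm211_bdpDisplay_pNew)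
    (h3c : ∀ (W : WeierstrassCurve ℚ) [W.IsElliptic] [W.IsGloballyMinimal],
      X2.BDPValueContinuousDisplayAt W 3)
    (hD : KellerYin2024.thmD_imcMult_exists_isBDPLFunction_isTorsion_charIdeal_eq_OPEN)
    (hMCB : Summit.BirchSwinnertonDyer.BirchSwinnertonDyer.Theses.EisensteinPrimes.MazurMCOnCellB) :
    Summit.BirchSwinnertonDyer.BirchSwinnertonDyer.Theses.EisensteinPrimes.BSDpOnCellC :=
  bsdpOnCellC_of_thmD_OPEN hPub (stub_c2_of_continuousDisplay_three h3c) hD hMCB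

/-- **The ψ-EVEN DOOR at every odd `p` with the value atom in continuous-function currency: `CellC ∩ {¬GVPar}
⇒ BSD(E,p)` from the 16 published facts + [cas-split] (`hPub`), the sign-free continuous display at `p = 3`
(`h3c`) and Keller–Yin Thm. D BY NAME (`hD`) — NO crux 3.** = `bsdpOnCellCNotGV_of_thmD_OPEN` (p497161) with
`stub_c2` supplied by §1. Census reading (no label moves here): once `h3c` is a theorem — kernel `lzz_rescale`
of LZZ18 Thm. 3.8 ∧ 3.10 ∧ Prop. 4.12 [PUB] (COMMISSION (O2)-LZZ@3), or road HK — EVERY ψ-even B11 entry (9 981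
@3 + 409 @5/@7 class-wide) reads «literal on Keller–Yin Thm. D [PRE] alone» by this name. A `conditional-result`.
[claim: KellerYin2024, status: under-review] [cite: KellerYin2024, Thm. D = Thm. 5.1.3 (arXiv:2402.12781v2 L306–L309)]
[cite: LiuZhangZhang2018, Thm. 3.8 and Thm. 3.10 (arXiv:1511.08172 p. 18) (intended source of h3c; nothing asserted)]
[cite: GreenbergVatsal2000, Thm. (1.3) and §2 p. 28] [cite: Hsieh2014, Thm. 1 (arXiv:1112.1580 pp. 3–4)]
[cite: CastellaEtAl2021, Thm. 5.3.1] [cite: Miller2011LMS, Def. 1.1] -/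
theorem bsdpOnCellCNotGV_of_continuousDisplay_three_of_thmD_OPEN
    (hPub : (lambdaMu_multiplicative_of_gvPar ∧ thm16_charIdeal_dvd_multiplicative_of_reducible ∧
      thm61_splitMultiplicative ∧ thm61_nonsplitMultiplicative ∧
      (∀ (W : WeierstrassCurve ℚ) [W.IsElliptic] [W.IsGloballyMinimal] (p : ℕ) [Fact p.Prime],
        greenberg_stevens (W := W) (p := p)) ∧
      exists_isNewformOf ∧
      (∀ (K : Type) [Field K] [NumberField K], poitouTate_selmerStructure_duality K) ∧
      (∀ (K : Type) [Field K] [NumberField K], poitouTate_sha_tateDual K) ∧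
      hsieh2014_exists_anticyclotomicPAdicLFunction ∧
      (∀ (N : ℕ) [NeZero N] (W : WeierstrassCurve ℚ) (K : Type) [Field K] [NumberField K],
        gross_zagier N W K) ∧
      (∀ (N : ℕ) [NeZero N] (W : WeierstrassCurve ℚ) (K : Type) [Field K] [NumberField K],
        kolyvagin N W K) ∧
      rank_eq_analyticRank_of_analyticRank_le_one ∧ HoffsteinLuo1997_exists_twist_L_one_ne_zero ∧
      mazur_not_dvd_maninConstant_of_odd ∧ bsdRHS_eq_of_isIsogenous) ∧
      thm210_thm211_bdpDisplay_pNew)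
    (h3c : ∀ (W : WeierstrassCurve ℚ) [W.IsElliptic] [W.IsGloballyMinimal],
      X2.BDPValueContinuousDisplayAt W 3)
    (hD : KellerYin2024.thmD_imcMult_exists_isBDPLFunction_isTorsion_charIdeal_eq_OPEN) :
    ∀ (W : WeierstrassCurve ℚ) [W.IsElliptic] [W.IsGloballyMinimal] (p : ℕ) [Fact p.Prime],
      CellC W p → ¬ GVPar W p → BSDp W p :=
  bsdpOnCellCNotGV_of_thmD_OPEN hPub (stub_c2_of_continuousDisplay_three h3c) hD

end Summit.BirchSwinnertonDyer.BirchSwinnertonDyer.Theorems.Reoriented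

end
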